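import Summits.QuantumAdvantage.QuantumAdvantage.Theorems.NearExactIsExact.Negative.TypeOTwelveDigits
import HarnessLib

/-!
# Type-O capacity on 12 bits: cubic isolation at `1963/2048` (NearExactIsExact, disprover's structure file)

Negative-side STRUCTURE for the crux `CubicForrelation.NearExactIsExact` (item `near_exact_is_exact`) at `n = 12`,
from the B2b disprover seat. HONEST FRAMING: this is a THEOREM about the finite slice `n = 12` (where the window
`(57/64, 1)` for cubic pairs is searched), NOT summit progress; it sharpens the certified isolation constant at
`n = 12` from `31/32 = 0.96875` (`isolation_twelve`) to `1963/2048 ≈ 0.95850` and pins down what a pair with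
`Φ ∈ (15/16, 1)` must look like (`window_forces_caseA`), which is what the counterexample search needs.

## The argument (Ax level of the 2-adic Walsh tower, one level deeper than parity)

For cubic `g : 𝔽₂¹² → 𝔽₂`, `W_g = 16·u` with `u ∈ ℤ` (`tw_base`). If some `u(x)` is odd then ALL are ("type O",
`typeO_of_exists_odd`: the parity `[u odd]` has degree `≤ 0`). For type O:
* DIGITS (`digit_two`, `digit_three`; Poisson over `E_I` + Ax on `E_{Iᶜ}`, the pattern of `stub_walshTower` with the
  side conditions `|I| + ⌈(12−|I|)/3⌉ ≥ 6` for `|I| ≥ 2` and `≥ 7` for `|I| ≥ 4`): writing `u = 2u₁ + 1`,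
  `u₁ = 2u₂ + (u₁ mod 2)`, the function `[u₁ odd]` is AFFINE and `[u₂ odd]` is CUBIC; hence
  `[u ≡ ±3 (mod 8)] = [u₂ odd] ⊕ [u₁ odd]` is cubic and `e := #{x : u(x) ≡ ±1 (mod 8)}` is `0` or `≥ 2^{12−3} = 512`
  (`bb_rmWeight_holds`).
* PARSEVAL `Σ u² = 2^{16}` and the pointwise `8|u| ≤ u² + 15 − 8·[u ≡ ±1 (mod 8)]` (odd `u`; equality iff `|u| ≤ 7`)
  give `Σ_x |u(x)| ≤ 15872 − e`; so `e ≥ 512 ⇒ Σ|W_g| ≤ 2^{18}·15/16`.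
* CASE A (`e = 0`, every `u ≡ ±3 (mod 8)`): with the affine second digit `τ = [u₁ odd]`, `s := (−1)^τ u ≡ 5 (mod 8)`,
  `64|s| ≤ 5s² + 6s + 165` pointwise, and `Σ s = Σ_x (−1)^{τ(x)} u(x) ≤ 256` because an affine sign pattern sees at
  most one Walsh value (`sum_signOf_affine_mul_W_le`: kernel symmetry + Ax with `d = 1` + Parseval); so
  `Σ|u| ≤ (5·2^{16} + 6·256 + 165·2^{12})/64 = 15704` and `Σ|W_g| ≤ 16·15704 = 2^{18}·(1963/2048)`.
With the landed tower (`tw_step` at levels `5, 6`: cost `15/16`; `tw_bent_end`: `Φ = 1 ∨ Φ ≤ 7/8`) this gives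
`isolation_twelve_1963` and `no_window_twelve_1963`; and `15/16 < Φ(f,g) < 1` forces BOTH `f` and `g` into case A
(`window_forces_caseA`, `_left`).

Search note (numerics of this seat, not used in the proofs): among ~10⁴ type-O cubics met by the B2b scans the minimum
`e` is `1400` (a quadratic coset of `c₃^{⊗4}`), random type-O cubics have `e ≈ 1900–2100`, and no case-A function
(`e = 0`) was found; the bound `Σ|u| + e ≤ 15872` is nearly tight (`Tr(x²¹)` on `𝔽_{4096}`: `13940 + 1912 = 15852`).

Sources: J. Ax (1964) / R. McEliece (1972) (Carlet 2021 §4.1); MacWilliams–Sloane Ch. 13–15 (Reed–Muller weights,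
Poisson summation); R. O'Donnell, Analysis of Boolean Functions (2014) §1.4 (Parseval). Axioms: the standard three.
-/

set_option linter.dupNamespace false -- D-0017: single-problem summit ⇒ `QuantumAdvantage.QuantumAdvantage` by design

noncomputable section

namespace Summit.QuantumAdvantage.QuantumAdvantage.Theorems.NearExactIsExact.Negative.TypeOTwelve

open Finset
open Literature.Computability.QuantumComplexity
open Literature.Computability.QuantumComplexity.DerivativeWalsh (W fsum fsum_eq_sum_mul_W fsum_eq_sum_mul_W' sum_W_sq)
open Summit.QuantumAdvantage.QuantumAdvantage.Theorems.CubicForrelation.NearExactIsExact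
open Summit.QuantumAdvantage.QuantumAdvantage.Theorems.SignedCubicForrelationNotPrBPP (knf_isDegLeFun_ip)
open Summit.QuantumAdvantage.QuantumAdvantage.Theorems.SignedCubicForrelationNotPrBPP.Negative.HalfQuad (forrelation_comm)

/-! ### The type-O capacity theorem -/

section TypeO

variable (g : (Fin (6 + 6) → Bool) → Bool) (u : (Fin (6 + 6) → Bool) → ℤ)

/-- **Type-O capacity on 12 bits.** Let `g : 𝔽₂¹² → 𝔽₂` be cubic with `W_g = 16·u`, `u(x)` ODD for every `x`
("type O": the 2-adic tower of `g` stops at the Ax level). Then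
* `Σ_x |W_g(x)| ≤ 16·(15872 − e)` where `e = #{x : u(x) ≡ ±1 (mod 8)}` — from the pointwise
  `8|u| ≤ u² + 15 − 8·[u ≡ ±1 (8)]` and Parseval `Σ u² = 2^{16}`;
* `e = 0` or `e ≥ 512`: `x ↦ [u(x) ≡ ±3 (mod 8)]` is the XOR of the second digit (affine, `digit_two`) and the third
  digit (cubic, `digit_three`), a cubic Boolean function, so its complement is `0` or has weight `≥ 2^{12−3}`;
* if `e = 0` then `s := ±u ≡ 5 (mod 8)` with the sign `(−1)^{τ}`, `τ` the (affine) second digit, satisfies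
  `64|s| ≤ 5s² + 6s + 165` pointwise and `Σ s = Σ (−1)^τ u ≤ 2^{12}/16 = 256` (`sum_signOf_affine_mul_W_le`), whence
  `Σ|u| ≤ (5·2^{16} + 6·256 + 165·2^{12})/64 = 15704`.
Hence `Σ_x |W_g(x)| ≤ 16 · 15704 = 2^{18} · (1963/2048)` always, and `≤ 2^{18} · (15/16)` unless `e = 0`. -/
theorem typeO_capacity (hg : IsDegLeFun 3 g) (hu : ∀ x, W (fun y => signOf (g y)) x = (2 : ℝ) ^ 4 * (u x : ℝ))
    (hodd : ∀ x, Odd (u x)) :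
    ∑ x, |W (fun y => signOf (g y)) x| ≤ (2 : ℝ) ^ (3 * 6) * (1963 / 2048) ∧
      ((∃ x, u x % 8 = 1 ∨ u x % 8 = 7) →
        ∑ x, |W (fun y => signOf (g y)) x| ≤ (2 : ℝ) ^ (3 * 6) * (15 / 16)) := by
  have hodd' : ∀ x, u x % 2 = 1 := fun x => Int.odd_iff.1 (hodd x)
  -- the digits `u = 2u₁ + 1`, `u₁ = 2u₂ + t`, `t = u₁ mod 2`
  obtain ⟨u₁, h1⟩ : ∃ u₁ : (Fin (6 + 6) → Bool) → ℤ, ∀ x, u x = 2 * u₁ x + 1 :=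
    ⟨fun x => (u x - 1) / 2, fun x => by
      show u x = 2 * ((u x - 1) / 2) + 1
      have := hodd' x
      omega⟩
  obtain ⟨t, ht2⟩ : ∃ t : (Fin (6 + 6) → Bool) → ℤ, ∀ x, t x = u₁ x % 2 := ⟨fun x => u₁ x % 2, fun x => rfl⟩
  obtain ⟨u₂, h2⟩ : ∃ u₂ : (Fin (6 + 6) → Bool) → ℤ, ∀ x, u₁ x = 2 * u₂ x + t x :=
    ⟨fun x => u₁ x / 2, fun x => by
      show u₁ x = 2 * (u₁ x / 2) + t x
      have := ht2 x
      omega⟩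
  have ht : ∀ x, t x = if Odd (u₁ x) then 1 else 0 := fun x => by
    by_cases h : Odd (u₁ x)
    · rw [if_pos h, ht2 x]; exact Int.odd_iff.1 h
    · rw [if_neg h, ht2 x]; exact Int.even_iff.1 (Int.not_odd_iff_even.1 h)
  have hτ : IsDegLeFun 1 (fun x => decide (Odd (u₁ x))) := digit_two g u hg hu u₁ h1
  have hκ : IsDegLeFun 3 (fun x => decide (Odd (u₂ x))) := digit_three g u hg hu u₁ u₂ t h1 h2 ht
  -- `Q = [u ≡ ±1 (mod 8)]`, the complement of the cubic `[u₂ odd] ⊕ [u₁ odd] = [u ≡ ±3 (mod 8)]`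
  obtain ⟨Q, hQdef⟩ : ∃ Q : (Fin (6 + 6) → Bool) → Bool,
      ∀ x, Q x = ((decide (Odd (u₂ x)) ^^ decide (Odd (u₁ x))) ^^ true) := ⟨_, fun x => rfl⟩
  have hQ : IsDegLeFun 3 Q := by
    rw [show Q = fun x => ((decide (Odd (u₂ x)) ^^ decide (Odd (u₁ x))) ^^ true) from funext hQdef]
    exact bb_isDegLeFun_bxor (bb_isDegLeFun_bxor hκ (hτ.mono (by norm_num))) (isDegLeFun_const 3 true)
  have hQ_iff : ∀ x, Q x = true ↔ (u x % 8 = 1 ∨ u x % 8 = 7) := by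
    intro x
    have e1 := h1 x
    have e2 := h2 x
    have e3 := ht2 x
    have key : (Odd (u₂ x) ↔ Odd (u₁ x)) ↔ (u x % 8 = 1 ∨ u x % 8 = 7) := by
      rw [Int.odd_iff, Int.odd_iff]
      omega
    rw [← key, hQdef x]
    by_cases a : Odd (u₂ x) <;> by_cases b : Odd (u₁ x) <;> simp [a, b]
  -- Parseval, the pointwise inequality, and its sum
  have hpar : ∑ x, u x ^ 2 = 2 ^ 16 := sum_u_sq g u hu
  have hkey : ∀ x, 8 * |u x| + 8 * (if Q x = true then 1 else 0 : ℤ) ≤ u x ^ 2 + 15 := by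
    intro x
    by_cases hq : Q x = true
    · rw [if_pos hq]
      have := pt_pm_one (u x) ((hQ_iff x).1 hq)
      linarith
    · rw [if_neg hq]
      have := pt_odd (u x) (hodd' x)
      linarith
  have hcardU : (#(univ : Finset (Fin (6 + 6) → Bool)) : ℤ) = 2 ^ 12 := by
    rw [card_univ, Fintype.card_fun, Fintype.card_bool, Fintype.card_fin]
    norm_num
  have hsumkey : 8 * ∑ x, |u x| + 8 * (#(univ.filter fun x => Q x = true) : ℤ) ≤ 2 ^ 16 + 15 * 2 ^ 12 := by
    have h := sum_le_sum fun x (_ : x ∈ univ) => hkey x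
    rw [sum_add_distrib, ← mul_sum, ← mul_sum, sum_boole, sum_add_distrib, hpar, sum_const, nsmul_eq_mul,
      hcardU] at h
    linarith
  have hW : ∑ x, |W (fun y => signOf (g y)) x| = 16 * ((∑ x, |u x| : ℤ) : ℝ) := by
    push_cast
    rw [mul_sum]
    refine sum_congr rfl fun x _ => ?_
    rw [hu x, abs_mul, abs_of_pos (by positivity : (0 : ℝ) < 2 ^ 4)]
    norm_num
  -- dichotomy on `e = #Q`
  by_cases hQex : ∃ x, Q x = true
  · have hrm := bb_rmWeight_holds (6 + 6) 3 Q hQ hQex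
    have he : (512 : ℤ) ≤ #(univ.filter fun x => Q x = true) := by
      have h' : 512 ≤ #(univ.filter fun x => Q x = true) := by
        have e12 : 2 ^ (6 + 6) = 2 ^ 3 * 512 := by norm_num
        rw [e12] at hrm
        exact Nat.le_of_mul_le_mul_left hrm (by norm_num)
      exact_mod_cast h'
    have hS : (∑ x, |u x| : ℤ) ≤ 15360 := by linarith
    have hSR : ∑ x, |(u x : ℝ)| ≤ 15360 := by
      have h' := hS
      exact_mod_cast h'
    have hcap : ∑ x, |W (fun y => signOf (g y)) x| ≤ (2 : ℝ) ^ (3 * 6) * (15 / 16) := by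
      rw [hW]
      push_cast
      linarith
    refine ⟨hcap.trans (by norm_num), fun _ => hcap⟩
  · push Not at hQex
    have h35 : ∀ x, u x % 8 = 3 ∨ u x % 8 = 5 := by
      intro x
      have hq := hQex x
      rw [Ne, hQ_iff] at hq
      have := hodd' x
      omega
    refine ⟨?_, fun ⟨x, hx⟩ => absurd hx (by have := h35 x; omega)⟩
    -- case A: the signed quotient `s = (−1)^τ u ≡ 5 (mod 8)` sums to at most `256`
    have hsign : ∀ x, signOf (decide (Odd (u₁ x))) * (u x : ℝ) =
        ((if u x % 8 = 5 then u x else -u x : ℤ) : ℝ) := by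
      intro x
      rcases h35 x with h3 | h5
      · have ho : Odd (u₁ x) := Int.odd_iff.2 (by have := h1 x; omega)
        rw [decide_eq_true ho, if_neg (by omega)]
        simp [signOf]
      · have he : ¬ Odd (u₁ x) := by
          rw [Int.not_odd_iff_even]
          exact Int.even_iff.2 (by have := h1 x; omega)
        rw [decide_eq_false he, if_pos h5]
        simp [signOf]
    have hA := sum_signOf_affine_mul_W_le g (fun x => decide (Odd (u₁ x))) hτ
    rw [sum_congr rfl fun x _ => by rw [hu x, mul_left_comm, hsign x], ← mul_sum] at hA
    have hS256 : (∑ x, (if u x % 8 = 5 then u x else -u x) : ℤ) ≤ 256 := by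
      have h' : ((∑ x, (if u x % 8 = 5 then u x else -u x) : ℤ) : ℝ) ≤ 256 := by
        push_cast at hA ⊢
        linarith
      exact_mod_cast h'
    have hkeyA : ∀ x, 64 * |u x| ≤ 5 * u x ^ 2 + 6 * (if u x % 8 = 5 then u x else -u x) + 165 := by
      intro x
      have h8 : (if u x % 8 = 5 then u x else -u x) % 8 = 5 := by
        split_ifs with h
        · exact h
        · have := h35 x
          omega
      have h5 := pt_five _ h8
      have habs : |(if u x % 8 = 5 then u x else -u x)| = |u x| := by split_ifs <;> simp
      have hsq : (if u x % 8 = 5 then u x else -u x) ^ 2 = u x ^ 2 := by split_ifs <;> ring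
      rw [habs, hsq] at h5
      exact h5
    have hsumA : 64 * ∑ x, |u x| ≤ 5 * 2 ^ 16 + 6 * 256 + 165 * 2 ^ 12 := by
      have h := sum_le_sum fun x (_ : x ∈ univ) => hkeyA x
      rw [← mul_sum, sum_add_distrib, sum_add_distrib, ← mul_sum, ← mul_sum, hpar, sum_const, nsmul_eq_mul,
        hcardU] at h
      linarith
    have hS : (∑ x, |u x| : ℤ) ≤ 15704 := by linarith
    have hSR : ∑ x, |(u x : ℝ)| ≤ 15704 := by
      have h' := hS
      exact_mod_cast h'
    rw [hW]
    push_cast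
    linarith

end TypeO

/-! ### Consequences for the crux at `n = 12` -/

/-- **Isolation at `1963/2048` on `12` bits** (improves the landed `isolation_twelve`, constant `31/32 = 1984/2048`).
For all cubic `f, g : 𝔽₂¹² → 𝔽₂`: `Φ(f,g) > 1963/2048 ⇒ Φ(f,g) = 1`. The Ax level `4` of the tower is now
priced by `typeO_capacity` (`≤ 1963/2048`) instead of `31/32`; levels `5, 6` cost `15/16` and the bent endgame `7/8`
exactly as in `isolation_twelve`. -/
theorem isolation_twelve_1963 :
    ∀ f g : (Fin (6 + 6) → Bool) → Bool, IsDegLeFun 3 f → IsDegLeFun 3 g →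
      1963 / 2048 < forrelation f g → forrelation f g = 1 := by
  intro f g hf hg hΦ
  obtain ⟨u₄, hu₄⟩ := tw_base g hg 4 (by norm_num)
  by_cases hodd : ∃ x, Odd (u₄ x)
  · have hall := typeO_of_exists_odd g u₄ hg hu₄ hodd
    have hcap := (typeO_capacity g u₄ hg hu₄ hall).1
    exfalso
    have := tw_forrelation_le_of_cap f g hcap
    linarith
  · push Not at hodd
    have hu₅ := tw_level_up g u₄ hu₄ hodd
    rcases tw_step (j := 5) (d := 1) g _ hg (by norm_num) hu₅ (by intro k hk hkn; omega) with hcap | ⟨u₆, hu₆⟩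
    · exfalso; have := tw_forrelation_le_of_cap f g hcap; norm_num at this; linarith
    rcases tw_top (d := 3) g u₆ hg hu₆ (by intro k hk hkn; omega) with hbent | hcap
    · rcases tw_bent_end (by norm_num) f g hf hg hbent with h | h
      · exact h
      · exfalso; norm_num at h; linarith
    · exfalso; have := tw_forrelation_le_of_cap f g hcap; norm_num at this; linarith

/-- **The window `(15/16, 1)` at `n = 12` forces case A.** If cubic `f, g` on `12` bits have `15/16 < Φ(f,g) ≠ 1`,
then `g` is of type O with EVERY `W_g(x)/16 ≡ ±3 (mod 8)` (`e = 0` in `typeO_capacity`); by `forrelation_comm` the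
same holds for `f`. No such cubic is known (search note in the file docstring). -/
theorem window_forces_caseA (f g : (Fin (6 + 6) → Bool) → Bool) (hf : IsDegLeFun 3 f) (hg : IsDegLeFun 3 g)
    (hlo : 15 / 16 < forrelation f g) (hne : forrelation f g ≠ 1) :
    ∃ u : (Fin (6 + 6) → Bool) → ℤ, (∀ x, W (fun y => signOf (g y)) x = (2 : ℝ) ^ 4 * (u x : ℝ)) ∧
      ∀ x, u x % 8 = 3 ∨ u x % 8 = 5 := by
  obtain ⟨u₄, hu₄⟩ := tw_base g hg 4 (by norm_num)
  refine ⟨u₄, hu₄, ?_⟩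
  by_cases hodd : ∃ x, Odd (u₄ x)
  · have hall := typeO_of_exists_odd g u₄ hg hu₄ hodd
    have h2 := (typeO_capacity g u₄ hg hu₄ hall).2
    intro x
    have hx : u₄ x % 2 = 1 := Int.odd_iff.1 (hall x)
    by_contra hcon
    have h17 : u₄ x % 8 = 1 ∨ u₄ x % 8 = 7 := by omega
    have := tw_forrelation_le_of_cap f g (h2 ⟨x, h17⟩)
    linarith
  · exfalso
    push Not at hodd
    have hu₅ := tw_level_up g u₄ hu₄ hodd
    rcases tw_step (j := 5) (d := 1) g _ hg (by norm_num) hu₅ (by intro k hk hkn; omega) with hcap | ⟨u₆, hu₆⟩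
    · have := tw_forrelation_le_of_cap f g hcap; norm_num at this; linarith
    rcases tw_top (d := 3) g u₆ hg hu₆ (by intro k hk hkn; omega) with hbent | hcap
    · rcases tw_bent_end (by norm_num) f g hf hg hbent with h | h
      · exact hne h
      · norm_num at h; linarith
    · have := tw_forrelation_le_of_cap f g hcap; norm_num at this; linarith

/-- The same window forces case A on the `f` side (`Φ` is symmetric). -/
theorem window_forces_caseA_left (f g : (Fin (6 + 6) → Bool) → Bool) (hf : IsDegLeFun 3 f) (hg : IsDegLeFun 3 g)
    (hlo : 15 / 16 < forrelation f g) (hne : forrelation f g ≠ 1) :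
    ∃ u : (Fin (6 + 6) → Bool) → ℤ, (∀ x, W (fun y => signOf (f y)) x = (2 : ℝ) ^ 4 * (u x : ℝ)) ∧
      ∀ x, u x % 8 = 3 ∨ u x % 8 = 5 := by
  rw [forrelation_comm] at hlo hne
  exact window_forces_caseA g f hg hf hlo hne

/-- **No cubic pair on `12` bits has `Φ ∈ (1963/2048, 1)`** — the `n = 12` slice of the negation of `NearExactIsExact`
is empty above `1963/2048 ≈ 0.95850` (the known maximum below `1` is `57/64 = 0.890625`, `F8ChainTwelve`). -/
theorem no_window_twelve_1963 :
    ¬ ∃ f g : (Fin (6 + 6) → Bool) → Bool, IsDegLeFun 3 f ∧ IsDegLeFun 3 g ∧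
      1963 / 2048 < forrelation f g ∧ forrelation f g < 1 := by
  rintro ⟨f, g, hf, hg, hlo, hhi⟩
  exact absurd (isolation_twelve_1963 f g hf hg hlo) (ne_of_lt hhi)

end Summit.QuantumAdvantage.QuantumAdvantage.Theorems.NearExactIsExact.Negative.TypeOTwelve
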